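import Summits.PneNP.PneNP.Theses.ExpanderLinearGenerators
import Summits.PneNP.PneNP.Theorems.ExpanderLinearGeneratorsLinearGeneratorModPFregeHardPolyCalc
import Literature.Computability.MetaComplexity.PolynomialCalculusSizeDegree
import Mathlib.Analysis.SpecialFunctions.Pow.Asymptotics
import HarnessLib

/-!
# The polynomial calculus SIZE rung under `LinearGeneratorModPFregeHard` (item stmt-PneNP-11444)

Route `PneNP/ExpanderLinearGenerators`, crux `LinearGeneratorModPFregeHard` (the `AC⁰[p]`-Frege
rung: for odd primes `p`, depth-`d` `textbookFrege(MOD_p)` refutations of the XOR-CNF of an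
`ℓ`-sparse `(n^(1-δ), 3ℓ/4)`-boundary-expanding unsolvable `𝔽₂`-system have size `≥ 2^(n^ε)` —
an instance of Krajíček's open Problem 15.6.1).  `…LinearGeneratorModPFregeHardPolyCalc.lean`
landed the DEGREE form of the rung beneath it (PC over `𝔽_p` needs degree `> (3ℓ/16) n^(1-δ)`,
Ben-Sasson–Impagliazzo / Alekhnovich–Razborov).  This file upgrades it to the SIZE form — the
exact shape of the crux, one proof system lower — through the size–degree trade-off of
Impagliazzo–Pudlák–Sgall (kernel-checked in
`Literature/…/PolynomialCalculusSizeDegree.lean`):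

* `exp_le_card_monomials_sumEncoding` — over every field `K` with `2 ≠ 0`: if the supports of
  `E : Fin m → LinEqMod 2 n` form an `(r, c)`-boundary expander (`c > 0`, `r ≥ 2`) and the rows
  are `ℓ`-sparse, then for all `D ≤ n`, `k` with `D + ℓ + k + 1 ≤ c r / 4`, every refutation of
  the clause polynomials `cnfPolys K (sumEncoding 1 E)` in the polynomial calculus with the
  variable rule (multilinear form, `MLPC.Derivable`; Clegg–Edmonds–Impagliazzo /
  Impagliazzo–Pudlák–Sgall) all of whose monomials lie in `M` has `|M| ≥ exp (D k / n)`.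
* `linearGeneratorModPFregeHard_polyCalcSize_rung` — **the PC-size rung** in the item's regime:
  for every odd prime `p`, `ℓ ≥ 1` and `0 < δ < 1/2` there are `ε > 0` (namely `(1 - 2δ)/2`) and
  `N` such that for `n ≥ N`, every `ℓ`-sparse system `E : Fin m → LinEqMod 2 n` whose supports form
  an `(n^(1-δ), 3ℓ/4)`-boundary expander has NO polynomial-calculus refutation over `𝔽_p` of its
  XOR-CNF using fewer than `2^(n^ε)` distinct monomials.  (Unsolvability is not needed; for
  `δ ≥ 1/2` the trade-off gives nothing, matching the resolution-size rung
  `…LinearGeneratorResolutionSize.lean`.)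

Non-vacuity (refutations exist for unsolvable `E`, by completeness of the calculus) is recorded in
the companion file `…PolyCalcSizeNonvacuous.lean`.

So on the item's instances: resolution width/size, PC/NS degree, and now PC SIZE over `𝔽_p`
are all kernel-checked at the crux's scale `2^{n^{Ω(1)}}`; by Buss et al. (1997) what separates
PC/`𝔽_p` size from `F_d(MOD_p)` size — the crux, Krajíček's Problem 15.6.1 — is the extension
polynomials of their translation.

References: R. Impagliazzo, P. Pudlák, J. Sgall, Comput. Complexity 8 (1999)
[ImpagliazzoPudlakSgall1999]; M. Clegg, J. Edmonds, R. Impagliazzo, STOC 1996;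
E. Ben-Sasson, R. Impagliazzo, Comput. Complexity 19 (2010) §4 [BenSassonImpagliazzo2010];
J. Krajíček, *Proof Complexity* (2019), Thm. 16.2.4, §15.6 [KrajicekProofComplexity2019].
-/

noncomputable section

set_option linter.dupNamespace false -- `Summit.PneNP.PneNP.…`: summit = sub-problem (D-0017)

namespace Summit.PneNP.PneNP.Theorems.PolyCalc

open Finset MvPolynomial Filter Literature.Computability.Complexity Literature.Computability.MetaComplexity
open Summit.PneNP.PneNP.Theorems.ModTwo

variable {K : Type*} [Field K] {n m : ℕ}

/-! ### Variables and degrees of the clause polynomials of `sumEncoding 1 E` -/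

/-- The falsity polynomial of a literal mentions only its variable. [folklore] -/
theorem vars_litFalsePolyK_subset (l : Literal ℕ) : (litFalsePolyK (K := K) l).vars ⊆ {l.1} := by
  classical
  unfold litFalsePolyK
  split
  · refine Finset.Subset.trans (vars_sub_subset (p := 1) (q := X l.1)) (Finset.union_subset ?_ ?_)
    · rw [vars_one]; exact Finset.empty_subset _
    · rw [vars_X]
  · rw [vars_X]

/-- A clause polynomial mentions only the variables of the clause. [folklore] -/
theorem vars_unsatPolyK_subset (C : Clause ℕ) :
    (unsatPolyK K C).vars ⊆ (C.map Prod.fst).toFinset := by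
  classical
  induction C with
  | nil => simp [unsatPolyK]
  | cons l C ih =>
    have h : unsatPolyK K (l :: C) = litFalsePolyK l * unsatPolyK K C := by
      rw [unsatPolyK, List.map_cons, List.prod_cons]; rfl
    rw [h, List.map_cons, List.toFinset_cons]
    refine (vars_mul _ _).trans (Finset.union_subset ?_ (ih.trans (Finset.subset_insert _ _)))
    exact (vars_litFalsePolyK_subset l).trans (Finset.singleton_subset_iff.2 (Finset.mem_insert_self _ _))

/-- **The clause polynomials of `sumEncoding 1 E` live on the variables `x_0, …, x_{n-1}`.**
[Beck 2017, Def. 5.6] [folklore] -/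
theorem vars_subset_range_of_mem_cnfPolys (E : Fin m → LinEqMod 2 n) {g : MvPolynomial ℕ K}
    (hg : g ∈ cnfPolys K (sumEncoding 1 E)) : g.vars ⊆ Finset.range n := by
  classical
  obtain ⟨C, hC, rfl⟩ := hg
  simp only [sumEncoding, List.mem_flatMap, List.mem_finRange, true_and] at hC
  obtain ⟨i, hi⟩ := hC
  obtain ⟨S, _, _, rfl⟩ := exists_of_mem_equationCNF_one hi
  refine (vars_unsatPolyK_subset _).trans fun v hv => ?_
  rw [List.map_map, List.mem_toFinset, List.mem_map] at hv
  obtain ⟨w, hw, rfl⟩ := hv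
  obtain ⟨j, _, hj⟩ := (mem_sort_supp_iff (E i)).1 hw
  rw [Finset.mem_range]
  simp only [Function.comp_apply, ← hj]
  exact j.isLt

/-- **… and have degree `≤ ℓ` when the rows are `ℓ`-sparse.** [Krajíček 2019, §6 (6.0.1)]
[folklore] -/
theorem totalDegree_le_of_mem_cnfPolys (E : Fin m → LinEqMod 2 n) {ℓ : ℕ}
    (hℓ : ∀ i, (E i).supp.card ≤ ℓ) {g : MvPolynomial ℕ K}
    (hg : g ∈ cnfPolys K (sumEncoding 1 E)) : g.totalDegree ≤ ℓ := by
  obtain ⟨C, hC, rfl⟩ := hg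
  obtain ⟨i, hlen, _, _⟩ := clause_sits_on_rows (K := K) E hC
  rw [totalDegree_unsatPolyK, hlen]
  exact hℓ i

/-! ### The size bound on an `(r, c)`-boundary expander -/

/-- **Polynomial calculus SIZE on the XOR-CNF of an `(r, c)`-boundary expander** (degree lower
bound of Ben-Sasson–Impagliazzo / Alekhnovich–Razborov fed into the size–degree trade-off of
Impagliazzo–Pudlák–Sgall).  Over a field `K` with `2 ≠ 0`, let `E : Fin m → LinEqMod 2 n` be
`ℓ`-sparse with supports forming an `(r, c)`-boundary expander (`c > 0`, `r ≥ 2`), and let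
`D ≤ n`, `k` satisfy `D + ℓ + k + 1 ≤ c r / 4`.  Then every refutation of the clause polynomials of
`sumEncoding 1 E` in the polynomial calculus with the variable rule (multilinear form) all of whose
monomials lie in the finite set `M` satisfies `exp (D k / n) ≤ |M|`.
[Impagliazzo–Pudlák–Sgall 1999; Ben-Sasson–Impagliazzo 2010, §4] [folklore] -/
theorem exp_le_card_monomials_sumEncoding (h2 : (2 : K) ≠ 0) (E : Fin m → LinEqMod 2 n)
    {r c : ℝ} (hexp : IsBoundaryExpander (fun i => (E i).supp.map Fin.valEmbedding) r c)
    (hc : 0 < c) (hr : 2 ≤ r) {ℓ : ℕ} (hℓ : ∀ i, (E i).supp.card ≤ ℓ) {D k : ℕ} (hDn : D ≤ n)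
    (hDk : ((D + ℓ + k + 1 : ℕ) : ℝ) ≤ c * r / 4) {M : Finset (ℕ →₀ ℕ)}
    (hM : MLPC.Derivable (cnfPolys K (sumEncoding 1 E)) (fun g => g.support ⊆ M) 1) :
    Real.exp (D * k / n) ≤ M.card := by
  have hnot := not_refutableInDegree_sumEncoding h2 E hexp hc hr hDk
  have := MLPC.exp_le_card_monomials (V := Finset.range n) (D := D) (d₀ := ℓ) (k := k)
    (by rwa [Finset.card_range]) (fun g hg => vars_subset_range_of_mem_cnfPolys E hg)
    (fun g hg => totalDegree_le_of_mem_cnfPolys E hℓ hg) hnot hM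
  rwa [Finset.card_range] at this

/-! ### The rung in the item's regime -/

/-- Eventually-true inequalities in `n` used to fix the parameters. [folklore] -/
theorem eventually_size_parameters {ℓ : ℕ} (hℓ : 1 ≤ ℓ) {δ : ℝ} (hδ0 : 0 < δ) (hδ : δ < 1 / 2) :
    ∀ᶠ n : ℕ in atTop, (1 : ℝ) ≤ n ∧ (2 : ℝ) ≤ (n : ℝ) ^ (1 - δ) ∧
      (ℓ : ℝ) + 3 ≤ 3 * ℓ / 32 * (n : ℝ) ^ (1 - δ) ∧ 3 * (ℓ : ℝ) / 32 ≤ (n : ℝ) ^ δ ∧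
      Real.log 2 ≤ 9 * (ℓ : ℝ) ^ 2 / 4096 * (n : ℝ) ^ ((1 - 2 * δ) / 2) := by
  have hℓpos : (0 : ℝ) < ℓ := by exact_mod_cast hℓ
  have hpow : ∀ a : ℝ, 0 < a → Tendsto (fun n : ℕ => (n : ℝ) ^ a) atTop atTop := fun a ha =>
    (tendsto_rpow_atTop ha).comp tendsto_natCast_atTop_atTop
  have h1 : ∀ᶠ n : ℕ in atTop, (1 : ℝ) ≤ n :=
    tendsto_natCast_atTop_atTop.eventually_ge_atTop 1
  have h2 : ∀ᶠ n : ℕ in atTop, (2 : ℝ) ≤ (n : ℝ) ^ (1 - δ) :=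
    (hpow (1 - δ) (by linarith)).eventually_ge_atTop 2
  have h3 : ∀ᶠ n : ℕ in atTop, (ℓ : ℝ) + 3 ≤ 3 * ℓ / 32 * (n : ℝ) ^ (1 - δ) := by
    have : Tendsto (fun n : ℕ => 3 * (ℓ : ℝ) / 32 * (n : ℝ) ^ (1 - δ)) atTop atTop :=
      (hpow (1 - δ) (by linarith)).const_mul_atTop (by positivity)
    exact this.eventually_ge_atTop _
  have h4 : ∀ᶠ n : ℕ in atTop, 3 * (ℓ : ℝ) / 32 ≤ (n : ℝ) ^ δ := (hpow δ hδ0).eventually_ge_atTop _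
  have h5 : ∀ᶠ n : ℕ in atTop,
      Real.log 2 ≤ 9 * (ℓ : ℝ) ^ 2 / 4096 * (n : ℝ) ^ ((1 - 2 * δ) / 2) := by
    have : Tendsto (fun n : ℕ => 9 * (ℓ : ℝ) ^ 2 / 4096 * (n : ℝ) ^ ((1 - 2 * δ) / 2))
        atTop atTop :=
      (hpow _ (by linarith)).const_mul_atTop (by positivity)
    exact this.eventually_ge_atTop _
  exact h1.and (h2.and (h3.and (h4.and h5)))

open Summit.PneNP.PneNP.Theses.ExpanderLinearGenerators in
/-- **The polynomial calculus SIZE rung of `LinearGeneratorModPFregeHard`.**  For every odd prime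
`p`, every locality `ℓ ≥ 1` and every `0 < δ < 1/2` there are `ε > 0` (namely `(1 - 2δ)/2`) and
`N` such that for all `n ≥ N` and every `ℓ`-sparse system `E : Fin m → LinEqMod 2 n` whose
supports form an `(n^(1-δ), 3/4·ℓ)`-boundary expander — the hypotheses of the item, minus
unsolvability — every refutation of the clause polynomials of `sumEncoding 1 E` in the polynomial
calculus over `𝔽_p` (variable rule, multilinear form: Clegg–Edmonds–Impagliazzo /
Impagliazzo–Pudlák–Sgall) uses at least `2^(n^ε)` distinct monomials: if all its monomials lie in
`M` then `2^(n^ε) ≤ |M|`.  This is the conclusion of the crux (`modProofSize π ≥ 2^(n^ε)`) for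
the proof system one rung below `F_d(MOD_p)`; by Buss et al. (1997) the gap between the two is the
extension polynomials of their translation (Krajíček 2019, §15.6, Problem 15.6.1).
[Impagliazzo–Pudlák–Sgall 1999; Ben-Sasson–Impagliazzo 2010, §4;
Krajíček 2019, Thm. 16.2.4] [folklore] -/
theorem linearGeneratorModPFregeHard_polyCalcSize_rung (p : ℕ) [Fact p.Prime] (hp2 : p ≠ 2)
    (ℓ : ℕ) (δ : ℝ) (hℓ : 1 ≤ ℓ) (hδ0 : 0 < δ) (hδ : δ < 1 / 2) :
    ∃ ε : ℝ, 0 < ε ∧ ∃ N : ℕ, ∀ n : ℕ, N ≤ n → ∀ (m : ℕ) (E : Fin m → LinEqMod 2 n),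
      (∀ i, (E i).supp.card ≤ ℓ) →
      IsBoundaryExpander (fun i => (E i).supp.map Fin.valEmbedding) ((n : ℝ) ^ (1 - δ))
        (3 / 4 * ℓ) →
      ∀ M : Finset (ℕ →₀ ℕ),
        MLPC.Derivable (cnfPolys (ZMod p) (sumEncoding 1 E)) (fun g => g.support ⊆ M) 1 →
        (2 : ℝ) ^ ((n : ℝ) ^ ε) ≤ M.card := by
  refine ⟨(1 - 2 * δ) / 2, by linarith, ?_⟩
  obtain ⟨N, hN⟩ := Filter.eventually_atTop.1 (eventually_size_parameters hℓ hδ0 hδ)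
  refine ⟨N, fun n hn m E hsparse hexp M hM => ?_⟩
  obtain ⟨h1, h2, h3, h4, h5⟩ := hN n hn
  have hnpos : (0 : ℝ) < n := by linarith
  set R : ℝ := (n : ℝ) ^ (1 - δ) with hR
  have hRpos : 0 < R := by rw [hR]; positivity
  -- `A = c r / 4` for `c = 3ℓ/4`, `r = R`
  set A : ℝ := 3 * ℓ / 16 * R with hA
  have hA2 : (ℓ : ℝ) + 3 ≤ A / 2 := by rw [hA]; linarith
  -- the parameters `D = k = ⌊(A - ℓ - 1)/2⌋`
  set D : ℕ := ⌊(A - ℓ - 1) / 2⌋₊ with hD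
  have hDle : (D : ℝ) ≤ (A - ℓ - 1) / 2 := Nat.floor_le (by linarith)
  have hDge : (A - ℓ - 1) / 2 - 1 ≤ D := by
    have := Nat.lt_floor_add_one ((A - ℓ - 1) / 2); linarith
  have hDA : A / 4 ≤ D := by linarith
  have hDn : D ≤ n := by
    have hRn : 3 * (ℓ : ℝ) / 32 * R ≤ n := by
      have hn1 : (n : ℝ) = (n : ℝ) ^ δ * R := by
        rw [hR, ← Real.rpow_add hnpos, add_sub_cancel, Real.rpow_one]
      rw [hn1]
      exact mul_le_mul_of_nonneg_right h4 hRpos.le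
    have : (D : ℝ) ≤ n := by linarith
    exact_mod_cast this
  have hDk : ((D + ℓ + D + 1 : ℕ) : ℝ) ≤ 3 / 4 * (ℓ : ℝ) * R / 4 := by
    push_cast
    have : 3 / 4 * (ℓ : ℝ) * R / 4 = A := by rw [hA]; ring
    rw [this]; linarith
  have hbound := exp_le_card_monomials_sumEncoding (two_ne_zero_zmod (Fact.out) hp2) E hexp
    (by positivity) h2 hsparse hDn hDk hM
  refine le_trans ?_ hbound
  rw [Real.rpow_def_of_pos (by norm_num : (0 : ℝ) < 2)]
  apply Real.exp_le_exp.2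
  -- `log 2 · n^ε ≤ D² / n`
  have hε : (n : ℝ) ^ (1 - 2 * δ) = (n : ℝ) ^ ((1 - 2 * δ) / 2) * (n : ℝ) ^ ((1 - 2 * δ) / 2) := by
    rw [← Real.rpow_add hnpos]; congr 1; ring
  have hR2 : R * R / n = (n : ℝ) ^ (1 - 2 * δ) := by
    rw [hR, ← Real.rpow_add hnpos, div_eq_mul_inv, ← Real.rpow_neg_one (n : ℝ),
      ← Real.rpow_add hnpos]
    congr 1; ring
  have hDD : 9 * (ℓ : ℝ) ^ 2 / 4096 * (n : ℝ) ^ (1 - 2 * δ) ≤ (D : ℝ) * D / n := by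
    rw [← hR2]
    have hA4 : A / 4 = 3 * ℓ / 64 * R := by rw [hA]; ring
    have h0 : 0 ≤ A / 4 := by rw [hA4]; positivity
    have hsq : A / 4 * (A / 4) ≤ (D : ℝ) * D := mul_le_mul hDA hDA h0 (by positivity)
    calc 9 * (ℓ : ℝ) ^ 2 / 4096 * (R * R / n) = A / 4 * (A / 4) / n := by rw [hA4]; ring
      _ ≤ D * D / n := div_le_div_of_nonneg_right hsq hnpos.le
  calc Real.log 2 * (n : ℝ) ^ ((1 - 2 * δ) / 2)
      ≤ 9 * (ℓ : ℝ) ^ 2 / 4096 * (n : ℝ) ^ ((1 - 2 * δ) / 2) * (n : ℝ) ^ ((1 - 2 * δ) / 2) :=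
        mul_le_mul_of_nonneg_right h5 (by positivity)
    _ = 9 * (ℓ : ℝ) ^ 2 / 4096 * (n : ℝ) ^ (1 - 2 * δ) := by rw [hε]; ring
    _ ≤ (D : ℝ) * D / n := hDD

end Summit.PneNP.PneNP.Theorems.PolyCalc
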